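import Summits.CriticalPhenomena.PercolationContinuityZ3.Theorems.SahiMasterFamilyKahnModuleTensor

/-!
# Kahn pairs: the OR-step with a NESTED fresh pair `(B ∨ U, C ∨ U')`, `U ⊆ U'`
# (lineage `prim-master-conj`, gen 56; `--supports stmt-CriticalPhenomena-4575`)

Setting of `…SahiMasterFamilyKahnModule{Prelim,,OrOr,Tensor}`: `X` (old space) and `Y` (fresh module) finite preorders with probability
weights `w, w'`, both Harris; `(g,h)` a Kahn pair of monotone indicators on `X` (`b = E g`, `c = E h`, `d = E(gh)`); `u ≤ u'` NESTED
monotone indicators on `Y` (`β = E u ≤ β' = E u'`).  The new pair on `X × Y` is `(bor g u, bor h u') = (B ∨ U, C ∨ U')`.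

* `kahnPair_bor_nested` — **THEOREM G9 of the lineage**: `(B ∨ U, C ∨ U')` with `U ⊆ U'` nested events of a fresh Harris block is a Kahn
  pair (`E₃(F, B∨U, C∨U') ≥ 0` for every monotone `F ≥ 0`).  This is the OR-analogue of `kahnPair_tensor_nested` (G8) and contains
  `kahnPair_or_left` (`u = 0`… in the mirror form, `u' = 1` trivial) and `kahnPair_or_or` (`u = u'`) as the two extreme cases.
* `kahnPair_bor_nested'` — the mirror orientation `(B ∨ U', C ∨ U)`.

PROOF (identity-level certificate, found with the lineage's law-level LP and verified as a polynomial identity).  Over `y ∈ Y` write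
`a, G, H, D` for the fibre functionals `E_X F_y, E_X(F_y g), E_X(F_y h), E_X(F_y gh)` and put
`Θᵤ = (1−β')(1−b)(1−c)·a + (H − D)`, `Θ_c = a − G − H + D`, `Θ' = G − D` (fibre expectations of `F_y` against the NONNEGATIVE densities
`(1−β')(1−b)(1−c) + h(1−g)`, `(1−g)(1−h)`, `g(1−h)`, hence monotone in `y`).  Then pointwise in `y`
`integrand(y) − (u−β)Θᵤ − u'(u−β)Θ_c − (u'−β')Θ'` equals
`(β'−β)(G − b a) + (1−β')(D − d a)` on `{u = 1}`, `((1−β) − (1−β')c)(G − b a) + (1−β')(D − d a)` on `{u = 0, u' = 1}`, and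
`(1−β')·E₃,X(F_y,g,h) + (β'−β)(D − b H)` on `{u' = 0}` — all nonnegative (Harris on `X`, conditional Harris, fibrewise Kahn, `β ≤ β'`);
and the three subtracted terms have nonnegative `Y`-expectation by Harris on `Y` (for `(Θᵤ,u)`, `(Θ_c u', u)`, `(Θ',u')`).
Nothing here asserts Kahn's Conjecture 5.  [this work]
-/

open Finset
open scoped BigOperators

namespace Summit.CriticalPhenomena.PercolationContinuityZ3.Theorems.SahiKahnModule

variable {X Y : Type*} [Fintype X] [Fintype Y] [Preorder X] [Preorder Y]

omit [Preorder X] [Preorder Y] in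
/-- Fibre form of `E(F · bor g u · bor h u')` for NESTED indicators `u u' = u`:
`= E_Y( u·a + (u'−u)·G + (1−u')·D )`. [this work] -/
theorem ex_F_bor_bor_nested (w : X → ℝ) (w' : Y → ℝ) (F : X × Y → ℝ) (g h : X → ℝ) {u u' : Y → ℝ}
    (huu : ∀ y, u y * u' y = u y) :
    ex (prodW w w') (F * bor g u * bor h u') =
      ex w' (fun y => u y * ex w (fun x => F (x, y)) + (u' y - u y) * ex w ((fun x => F (x, y)) * g)
        + (1 - u' y) * ex w ((fun x => F (x, y)) * g * h)) := by
  rw [ex_prodW]; refine congrArg _ (funext fun y => ?_)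
  unfold ex; rw [mul_sum, mul_sum, mul_sum, ← sum_add_distrib, ← sum_add_distrib]
  exact sum_congr rfl fun x _ => by
    simp only [Pi.mul_apply, bor]
    linear_combination (w x * F (x, y) * (1 - g x - h x + g x * h x)) * huu y

omit [Preorder X] [Preorder Y] in
/-- `E(bor g u · bor h u') = β + (β'−β)·b + (1−β')·d` for nested indicators `u u' = u` (probability weights). [this work] -/
theorem ex_bor_bor_nested (w : X → ℝ) (w' : Y → ℝ) (hw : IsProbWeight w) (hw' : IsProbWeight w') (g h : X → ℝ)
    {u u' : Y → ℝ} (huu : ∀ y, u y * u' y = u y) :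
    ex (prodW w w') (bor g u * bor h u') =
      ex w' u + (ex w' u' - ex w' u) * ex w g + (1 - ex w' u') * ex w (g * h) := by
  rw [ex_prodW]
  have : (fun y => ex w fun x => (bor g u * bor h u' : X × Y → ℝ) (x, y)) =
      ((fun y => (1 - ex w g) * u y) + fun y => (ex w g - ex w (g * h)) * u' y) + fun _ => ex w (g * h) := by
    funext y; simp only [Pi.add_apply]
    have e : (fun x => (bor g u * bor h u' : X × Y → ℝ) (x, y)) =
        ((fun x => (u' y - u y) * g x) + fun x => (1 - u' y) * (g * h) x) + fun _ => u y := by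
      funext x; simp only [bor, Pi.add_apply, Pi.mul_apply]
      linear_combination (1 - g x - h x + g x * h x) * huu y
    rw [e, ex_add, ex_add, ex_smul, ex_smul, ex_const hw]; ring
  rw [this, ex_add, ex_add, ex_smul, ex_smul, ex_const hw']; ring

/-- **THEOREM G9 — the OR-step with a nested fresh pair.**  If `(g,h)` is a Kahn pair of monotone indicators on the Harris probability
space `X` and `u ≤ u'` are nested monotone indicators on the Harris probability space `Y`, then `(bor g u, bor h u') = (B ∨ U, C ∨ U')` is a
Kahn pair on `X × Y`: `E₃(F, B ∨ U, C ∨ U') ≥ 0` for every monotone `F ≥ 0`.  (Identity-level certificate; see the module docstring.) [this work] -/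
theorem kahnPair_bor_nested {w : X → ℝ} {w' : Y → ℝ} (hw : IsProbWeight w) (hw' : IsProbWeight w') (hX : IsHarris w)
    (hY : IsHarris w') {g h : X → ℝ} {u u' : Y → ℝ} (hg : IsIndicator g) (hh : IsIndicator h) (hgm : Monotone g)
    (hhm : Monotone h) (hu : IsIndicator u) (hu' : IsIndicator u') (hum : Monotone u) (hu'm : Monotone u')
    (hle : ∀ y, u y ≤ u' y) (hK : KahnPair w g h) :
    KahnPair (prodW w w') (bor g u) (bor h u') := by
  intro F hF hF0
  -- nestedness: u·u' = u pointwise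
  have huu : ∀ y, u y * u' y = u y := fun y => by
    rcases hu y with h0 | h1
    · simp [h0]
    · have : u' y = 1 := le_antisymm (hu'.le_one y) (h1 ▸ hle y); simp [h1, this]
  -- fibre quantities
  set a : Y → ℝ := fun y => ex w (fun x => F (x, y)) with ha
  set D : Y → ℝ := fun y => ex w ((fun x => F (x, y)) * g * h) with hD
  set G : Y → ℝ := fun y => ex w ((fun x => F (x, y)) * g) with hG
  set H : Y → ℝ := fun y => ex w ((fun x => F (x, y)) * h) with hH
  have hbm := ex_indicator_mem hw hg
  have hcm := ex_indicator_mem hw hh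
  have hpm := ex_indicator_mem hw' hu
  have hqm := ex_indicator_mem hw' hu'
  have hpq' : ex w' u ≤ ex w' u' := ex_mono hw'.nonneg hle
  -- plain real parameters
  obtain ⟨b, hb'⟩ : ∃ b : ℝ, b = ex w g := ⟨_, rfl⟩
  obtain ⟨c, hc'⟩ : ∃ c : ℝ, c = ex w h := ⟨_, rfl⟩
  obtain ⟨d, hd'⟩ : ∃ d : ℝ, d = ex w (g * h) := ⟨_, rfl⟩
  obtain ⟨p, hp'⟩ : ∃ p : ℝ, p = ex w' u := ⟨_, rfl⟩
  obtain ⟨q, hq'⟩ : ∃ q : ℝ, q = ex w' u' := ⟨_, rfl⟩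
  rw [← hb'] at hbm; rw [← hc'] at hcm; rw [← hp'] at hpm hpq'; rw [← hq'] at hqm hpq'
  -- the three transfer functionals
  set kk : ℝ := (1 - q) * (1 - b) * (1 - c) with hkk
  have hkk0 : 0 ≤ kk := mul_nonneg (mul_nonneg (sub_nonneg.2 hqm.2) (sub_nonneg.2 hbm.2)) (sub_nonneg.2 hcm.2)
  set Tu : Y → ℝ := fun y => kk * a y + (H y - D y) with hTu
  set Tc : Y → ℝ := fun y => a y - G y - H y + D y with hTc
  set Tp : Y → ℝ := fun y => G y - D y with hTp
  have eTu : (fun y => ex w (fun x => F (x, y) * (kk + h x * (1 - g x)))) = Tu := by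
    funext y; simp only [hTu, ha, hH, hD]; rw [← ex_smul, ← ex_sub, ← ex_add]
    refine congrArg _ (funext fun x => ?_); simp only [Pi.mul_apply, Pi.sub_apply, Pi.add_apply]; ring
  have eTc : (fun y => ex w (fun x => F (x, y) * ((1 - g x) * (1 - h x)))) = Tc := by
    funext y; simp only [hTc, ha, hG, hH, hD]; rw [← ex_sub, ← ex_sub, ← ex_add]
    refine congrArg _ (funext fun x => ?_); simp only [Pi.mul_apply, Pi.sub_apply, Pi.add_apply]; ring
  have eTp : (fun y => ex w (fun x => F (x, y) * (g x * (1 - h x)))) = Tp := by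
    funext y; simp only [hTp, hG, hD]; rw [← ex_sub]
    refine congrArg _ (funext fun x => ?_); simp only [Pi.mul_apply, Pi.sub_apply]; ring
  have Tum : Monotone Tu := by
    rw [← eTu]; exact monotone_ex_fibre_mul hw.nonneg hF fun x =>
      add_nonneg hkk0 (mul_nonneg (hh.nonneg x) (sub_nonneg.2 (hg.le_one x)))
  have Tcm : Monotone Tc := by
    rw [← eTc]; exact monotone_ex_fibre_mul hw.nonneg hF fun x =>
      mul_nonneg (sub_nonneg.2 (hg.le_one x)) (sub_nonneg.2 (hh.le_one x))
  have Tc0 : ∀ y, 0 ≤ Tc y := fun y => by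
    have e := congrFun eTc y; rw [← e]
    exact ex_nonneg hw.nonneg fun x => mul_nonneg (hF0 (x, y)) (mul_nonneg (sub_nonneg.2 (hg.le_one x)) (sub_nonneg.2 (hh.le_one x)))
  have Tpm : Monotone Tp := by
    rw [← eTp]; exact monotone_ex_fibre_mul hw.nonneg hF fun x => mul_nonneg (hg.nonneg x) (sub_nonneg.2 (hh.le_one x))
  have Tcum : Monotone (fun y => Tc y * u' y) := Tcm.mul hu'm Tc0 hu'.nonneg
  -- Harris on Y, three times
  have covu := hY.ex_mul_sub_nonneg Tum hum
  have covc := hY.ex_mul_sub_nonneg Tcum hum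
  have covp := hY.ex_mul_sub_nonneg Tpm hu'm
  rw [← hp'] at covu covc; rw [← hq'] at covp
  -- fibre inequalities on X (for each y)
  have iG : ∀ y, b * a y ≤ G y := fun y => by
    have := hX _ g (monotone_fibre_left hF y) hgm; simp only [hG, ha, hb']; linarith
  have iD : ∀ y, d * a y ≤ D y := fun y => by
    have := hX _ (g * h) (monotone_fibre_left hF y) (hgm.mul hhm hg.nonneg hh.nonneg)
    simp only [hD, ha, hd', ← mul_assoc] at this ⊢; linarith
  have iDH : ∀ y, b * H y ≤ D y := fun y => by
    have := hX ((fun x => F (x, y)) * h) g ((monotone_fibre_left hF y).mul hhm (fun x => hF0 (x, y)) hh.nonneg) hgm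
    have e : (fun x => F (x, y)) * h * g = (fun x => F (x, y)) * g * h := by ext x; simp only [Pi.mul_apply]; ring
    simp only [hD, hH, hb']; rw [← e]; linarith
  have ih : ∀ y, 0 ≤ 2 * D y - G y * c - H y * b - d * a y + a y * b * c := fun y => by
    have := hK _ (monotone_fibre_left hF y) fun x => hF0 (x, y); unfold kahnK at this
    simpa only [hD, hG, hH, ha, hb', hc', hd'] using this
  -- the functional in fibre form
  have e1 := ex_F_bor_bor_nested w w' F g h huu
  have e2 := ex_F_bor w w' F g u
  have e3 := ex_F_bor w w' F h u'
  have e4 := ex_bor w w' hw hw' g u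
  have e5 := ex_bor w w' hw hw' h u'
  have e6 := ex_bor_bor_nested w w' hw hw' g h huu
  have e7 : ex (prodW w w') F = ex w' a := ex_prodW _ _ _
  have key : kahnK (prodW w w') F (bor g u) (bor h u') = ex w' (fun y =>
      2 * (u y * a y + (u' y - u y) * G y + (1 - u' y) * D y) - (q + (1 - q) * c) * (u y * a y + (1 - u y) * G y)
        - (p + (1 - p) * b) * (u' y * a y + (1 - u' y) * H y) - (p + (q - p) * b + (1 - q) * d) * a y
        + (p + (1 - p) * b) * (q + (1 - q) * c) * a y) := by
    unfold kahnK; rw [e1, e2, e3, e4, e5, e6, e7, ← hb', ← hc', ← hd', ← hp', ← hq', ex_lin_tensor_lhs]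
  -- pointwise lower bound by the three transfers
  have pt : ∀ y, ((fun y => Tu y * (u y - p)) + (fun y => Tc y * u' y * (u y - p)) + fun y => Tp y * (u' y - q)) y ≤
      2 * (u y * a y + (u' y - u y) * G y + (1 - u' y) * D y) - (q + (1 - q) * c) * (u y * a y + (1 - u y) * G y)
        - (p + (1 - p) * b) * (u' y * a y + (1 - u' y) * H y) - (p + (q - p) * b + (1 - q) * d) * a y
        + (p + (1 - p) * b) * (q + (1 - q) * c) * a y := by
    intro y
    simp only [Pi.add_apply, hTu, hTc, hTp]
    have hG' := iG y; have hD' := iD y; have hDH := iDH y; have ihy := ih y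
    rcases hu y with u0 | u1 <;> rcases hu' y with v0 | v1
    · -- cell u' = 0 : fibre Kahn + conditional Harris
      rw [u0, v0]
      linarith [mul_nonneg (sub_nonneg.2 hqm.2) ihy, mul_nonneg (sub_nonneg.2 hpq') (sub_nonneg.2 hDH)]
    · -- cell u = 0, u' = 1 : Harris (f,g) and (f,gh)
      rw [u0, v1]
      have hcoef : 0 ≤ (1 - p) - (1 - q) * c := by
        linarith [mul_nonneg (sub_nonneg.2 hqm.2) (sub_nonneg.2 hcm.2), hpq']
      linarith [mul_nonneg hcoef (sub_nonneg.2 hG'), mul_nonneg (sub_nonneg.2 hqm.2) (sub_nonneg.2 hD')]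
    · -- u = 1, u' = 0 contradicts nestedness
      exfalso; have := hle y; rw [u1, v0] at this; linarith
    · -- cell u = 1 : Harris (f,g) and (f,gh)
      rw [u1, v1]
      linarith [mul_nonneg (sub_nonneg.2 hpq') (sub_nonneg.2 hG'), mul_nonneg (sub_nonneg.2 hqm.2) (sub_nonneg.2 hD')]
  rw [key]
  calc (0:ℝ) ≤ ex w' (fun y => Tu y * (u y - p)) + ex w' (fun y => Tc y * u' y * (u y - p)) + ex w' (fun y => Tp y * (u' y - q)) :=
        add_nonneg (add_nonneg covu covc) covp
    _ = ex w' (((fun y => Tu y * (u y - p)) + fun y => Tc y * u' y * (u y - p)) + fun y => Tp y * (u' y - q)) := by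
        rw [ex_add, ex_add]
    _ ≤ _ := ex_mono hw'.nonneg pt

/-- The mirror orientation: `(bor g u', bor h u) = (B ∨ U', C ∨ U)` with `u ≤ u'` is a Kahn pair as well
(apply `kahnPair_bor_nested` to the swapped pair `(h,g)`). [this work] -/
theorem kahnPair_bor_nested' {w : X → ℝ} {w' : Y → ℝ} (hw : IsProbWeight w) (hw' : IsProbWeight w') (hX : IsHarris w)
    (hY : IsHarris w') {g h : X → ℝ} {u u' : Y → ℝ} (hg : IsIndicator g) (hh : IsIndicator h) (hgm : Monotone g)
    (hhm : Monotone h) (hu : IsIndicator u) (hu' : IsIndicator u') (hum : Monotone u) (hu'm : Monotone u')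
    (hle : ∀ y, u y ≤ u' y) (hK : KahnPair w g h) :
    KahnPair (prodW w w') (bor g u') (bor h u) :=
  (kahnPair_bor_nested hw hw' hX hY hh hg hhm hgm hu hu' hum hu'm hle hK.symm).symm

end Summit.CriticalPhenomena.PercolationContinuityZ3.Theorems.SahiKahnModule
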